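import Mathlib.Topology.MetricSpace.Contracting
import Mathlib.Topology.MetricSpace.Sequences
import Mathlib.Topology.MetricSpace.ProperSpace.Real
import Mathlib.Analysis.Normed.Group.Constructions
import Mathlib.Analysis.SpecificLimits.Basic
import Mathlib.Data.Fintype.Pigeonhole
import Mathlib.Order.Filter.Cofinite
import Literature.Computability.Complexity.MeanPayoffGame
import HarnessLib

/-!
# Positional determinacy of mean-payoff games: proof of the Ehrenfeucht–Mycielski theorem

This file discharges the named fact
`Literature.Computability.Complexity.EhrenfeuchtMycielski1979_positionalDeterminacy` of
`Literature.Computability.Complexity.MeanPayoffGame`: on a finite arena without sinks both players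
have POSITIONAL strategies securing the value, Max in the `liminf` sense and Min in the `limsup`
sense [EhrenfeuchtMycielski1979; restated ZwickPaterson1995 §1]. We prove the uniform version
(`MeanPayoffGame.exists_positional_optimal`: one pair `σ, τ` optimal from every start vertex).

## The proof (vanishing discount, by compactness)

Ehrenfeucht and Mycielski argue through the finite "first cycle" game; Gurvich–Karzanov–Khachiyan
through potential transformations. We follow instead the discounted road of
[ZwickPaterson1995, §5] (Thm 8: the discounted values are the unique solution of the optimality
equations; Thm 9: they converge to the mean-payoff values), in a soft form that needs no path or
cycle combinatorics and no rationality argument: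

1. `exists_discountedValue`: for a discount factor `0 ≤ c < 1` the Shapley operator
   `(T x) u = max / min_{u → u'} (w(u,u') + c · x u')` is a `c`-contraction of the sup-metric space
   `V → ℝ`, so (Banach) it has a fixed point `x_c`; the greedy selections `σ_c` (argmax) and `τ_c`
   (argmin) are legal positional strategies.
2. Pigeonhole: along `c_n = 1 - 1/(n+1) → 1` some pair `(σ, τ)` is greedy for infinitely many `n`;
   by Bolzano–Weierstrass in `ℝ^V` a further subsequence has `(1 - c_n) · x_{c_n} → ν` pointwise
   (`|(1 - c) x_c| ≤ max |w|`).
3. Passing to the limit in the optimality equations multiplied by `1 - c_n`: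
   `ν (σ u) = ν u ≥ ν u'` at Max vertices and `ν (τ u) = ν u ≤ ν u'` at Min vertices, for all
   edges `u → u'`; hence `ν` is non-decreasing along every play conforming to `σ` and
   non-increasing along every play conforming to `τ`.
4. `securesGe_of_vanishingDiscount` (telescoping): along a play `ρ` conforming to `σ`,
   `w(ρ i, ρ (i+1)) ≥ x(ρ i) - c · x(ρ (i+1)) = (1 - c) x(ρ i) + c (x(ρ i) - x(ρ (i+1)))`, and
   `(1 - c) x(ρ i) ≥ ν(ρ i) - δ ≥ ν(ρ 0) - δ` once `(1 - c) x` is `δ`-close to `ν`; summing,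
   `Σ_{i<n} w ≥ n (ν(ρ 0) - δ) - 2 max|x|`, which is the `liminf` claim. The Min side is the Max
   side of the arena with owners swapped and weights negated (`securesLe_of_vanishingDiscount`).

## References

* A. Ehrenfeucht, J. Mycielski, *Positional strategies for mean payoff games*, Int. J. Game
  Theory 8 (1979) 109–113 (the theorem).
* U. Zwick, M. S. Paterson, *The complexity of mean payoff games*, COCOON 1995, LNCS 959, 1–10,
  §5 (discounted payoff games, Thms 8–9); Theoret. Comput. Sci. 158 (1996) 343–359.
-/

open Filter Topology

namespace Literature.Computability.Complexity

namespace MeanPayoffGame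

variable {V : Type*}

section VanishingDiscount

variable [Finite V]

/-- **Max side of the vanishing-discount argument.** Let `σ` be a positional strategy of Max and
`ν : V → ℝ` a function that does not decrease along `σ` at Max vertices nor along any edge at Min
vertices, and suppose that for every `δ > 0` there are a discount factor `c ∈ [0,1]` and a vector
`x` with `(1 - c) • x` uniformly `δ`-close to `ν` satisfying Max's half of the discounted
optimality inequalities for `σ` (`x u ≤ w(u,σ u) + c x(σ u)` at Max vertices,
`x u ≤ w(u,u') + c x u'` along all edges at Min vertices). Then `σ` secures mean payoff `≥ ν v`
from every `v` (telescoping, see the module docstring). [folklore] -/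
theorem securesGe_of_vanishingDiscount (G : MeanPayoffGame V ℝ) (σ : V → V) (ν : V → ℝ)
    (hmono₁ : ∀ u, G.owner u = true → ν u ≤ ν (σ u))
    (hmono₂ : ∀ u, G.owner u = false → ∀ u', G.Adj u u' → ν u ≤ ν u')
    (happrox : ∀ δ : ℝ, 0 < δ → ∃ (c : ℝ) (x : V → ℝ), 0 ≤ c ∧ c ≤ 1 ∧
      (∀ u, |(1 - c) * x u - ν u| ≤ δ) ∧
      (∀ u, G.owner u = true → x u ≤ G.weight u (σ u) + c * x (σ u)) ∧
      (∀ u, G.owner u = false → ∀ u', G.Adj u u' → x u ≤ G.weight u u' + c * x u'))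
    (v : V) : G.SecuresGe (positional σ) v (ν v) := by
  intro ρ h0 hplay hconf ε hε
  rw [conforms_positional_iff] at hconf
  -- `ν` does not decrease along the play
  have hν : ∀ i, ν v ≤ ν (ρ i) := by
    intro i
    induction i with
    | zero => rw [h0]
    | succ i ih =>
      refine ih.trans ?_
      cases h : G.owner (ρ i)
      · exact hmono₂ _ h _ (hplay i)
      · rw [hconf i h]
        exact hmono₁ _ h
  obtain ⟨c, x, hc0, hc1, hclose, hmax, hmin⟩ := happrox (ε / 2) (half_pos hε)
  -- one step of the discounted inequality along the play
  have hstep : ∀ i, x (ρ i) ≤ G.weight (ρ i) (ρ (i + 1)) + c * x (ρ (i + 1)) := by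
    intro i
    cases h : G.owner (ρ i)
    · exact hmin _ h _ (hplay i)
    · rw [hconf i h]
      exact hmax _ h
  -- telescoping
  have htel : ∀ n : ℕ,
      (ν v - ε / 2) * n + c * (x (ρ 0) - x (ρ n)) ≤ G.partialSum ρ n := by
    intro n
    induction n with
    | zero => simp
    | succ n ih =>
      rw [partialSum_succ, Nat.cast_succ]
      have h1 := hstep n
      have h2 : ν (ρ n) - ε / 2 ≤ (1 - c) * x (ρ n) := by
        have := (abs_le.1 (hclose (ρ n))).1
        linarith
      have h3 := hν n
      linarith
  -- `x` is bounded on the finite vertex set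
  obtain ⟨M, hM⟩ := Finite.exists_le fun u : V => |x u|
  have hM0 : 0 ≤ M := (abs_nonneg _).trans (hM v)
  obtain ⟨N, hN⟩ := exists_nat_ge (4 * M / ε)
  refine eventually_atTop.2 ⟨N, fun n hn => ?_⟩
  have h5 : (N : ℝ) ≤ n := Nat.cast_le.2 hn
  have h6 : 4 * M ≤ ε * n := by
    have := (div_le_iff₀ hε).1 (hN.trans h5)
    linarith [mul_comm (n : ℝ) ε]
  have h7 : -(2 * M) ≤ c * (x (ρ 0) - x (ρ n)) := by
    have a1 := (abs_le.1 (hM (ρ 0))).1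
    have a2 := (abs_le.1 (hM (ρ n))).2
    have h8 : -(2 * M) ≤ x (ρ 0) - x (ρ n) := by linarith
    nlinarith
  calc (ν v - ε) * n = (ν v - ε / 2) * n - ε * n / 2 := by ring
    _ ≤ (ν v - ε / 2) * n + c * (x (ρ 0) - x (ρ n)) := by linarith
    _ ≤ G.partialSum ρ n := htel n

/-- **Min side of the vanishing-discount argument**: the Max side
(`securesGe_of_vanishingDiscount`) for the arena with owners swapped and weights negated. Here
`ν` does not increase along `τ` at Min vertices nor along any edge at Max vertices, and `x`
satisfies Min's half of the discounted optimality inequalities for `τ`. [folklore] -/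
theorem securesLe_of_vanishingDiscount (G : MeanPayoffGame V ℝ) (τ : V → V) (ν : V → ℝ)
    (hmono₁ : ∀ u, G.owner u = false → ν (τ u) ≤ ν u)
    (hmono₂ : ∀ u, G.owner u = true → ∀ u', G.Adj u u' → ν u' ≤ ν u)
    (happrox : ∀ δ : ℝ, 0 < δ → ∃ (c : ℝ) (x : V → ℝ), 0 ≤ c ∧ c ≤ 1 ∧
      (∀ u, |(1 - c) * x u - ν u| ≤ δ) ∧
      (∀ u, G.owner u = false → G.weight u (τ u) + c * x (τ u) ≤ x u) ∧
      (∀ u, G.owner u = true → ∀ u', G.Adj u u' → G.weight u u' + c * x u' ≤ x u))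
    (v : V) : G.SecuresLe (positional τ) v (ν v) := by
  -- the dual arena: owners swapped, weights negated
  let G' : MeanPayoffGame V ℝ :=
    { Adj := G.Adj, owner := fun u => !G.owner u, weight := fun u u' => -G.weight u u' }
  have hown : ∀ u, G'.owner u = !G.owner u := fun _ => rfl
  have hwt : ∀ u u', G'.weight u u' = -G.weight u u' := fun _ _ => rfl
  have key : G'.SecuresGe (positional τ) v (-ν v) := by
    refine securesGe_of_vanishingDiscount G' τ (fun u => -ν u) ?_ ?_ ?_ v
    · intro u hu
      rw [hown, Bool.not_eq_true'] at hu
      exact neg_le_neg (hmono₁ u hu)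
    · intro u hu u' huu'
      rw [hown, Bool.not_eq_false'] at hu
      exact neg_le_neg (hmono₂ u hu u' huu')
    · intro δ hδ
      obtain ⟨c, x, hc0, hc1, hclose, hmin, hmax⟩ := happrox δ hδ
      refine ⟨c, fun u => -x u, hc0, hc1, fun u => ?_, fun u hu => ?_, fun u hu u' huu' => ?_⟩
      · rw [← abs_neg]
        convert hclose u using 2
        ring
      · rw [hown, Bool.not_eq_true'] at hu
        rw [hwt]
        linarith [hmin u hu]
      · rw [hown, Bool.not_eq_false'] at hu
        rw [hwt]
        linarith [hmax u hu u' huu']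
  -- translate back
  intro ρ h0 hplay hconf ε hε
  have hconf' : G'.Conforms true (positional τ) ρ := by
    intro i hi
    rw [hown, Bool.not_eq_true'] at hi
    exact hconf i hi
  have hps : ∀ n, G'.partialSum ρ n = -G.partialSum ρ n := by
    intro n
    induction n with
    | zero => simp
    | succ n ih => rw [partialSum_succ, partialSum_succ, ih, hwt]; ring
  filter_upwards [key ρ h0 hplay hconf' ε hε] with n hn
  rw [hps] at hn
  linarith

end VanishingDiscount

section Discounted

variable [Fintype V]

/-- **Discounted games are positionally solvable.** On a finite arena without sinks and for a
discount factor `0 ≤ c < 1` there are a value vector `x : V → ℝ` and everywhere-legal greedy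
positional strategies `σ` (argmax of `w(u,u') + c · x u'` over the out-edges of `u`) and `τ`
(argmin) such that `x u = w(u,σ u) + c · x(σ u)` at Max vertices and `x u = w(u,τ u) + c · x(τ u)`
at Min vertices — the optimality equations of the discounted payoff game, whose solution is the
unique fixed point of a `c`-contraction of `ℝ^V` (Banach). [cite: ZwickPaterson1995, §5 Thm 8] -/
theorem exists_discountedValue (G : MeanPayoffGame V ℝ) (hG : G.IsTotal) {c : ℝ} (hc0 : 0 ≤ c)
    (hc1 : c < 1) :
    ∃ (x : V → ℝ) (σ τ : V → V),
      (∀ u, G.Adj u (σ u) ∧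
        ∀ u', G.Adj u u' → G.weight u u' + c * x u' ≤ G.weight u (σ u) + c * x (σ u)) ∧
      (∀ u, G.Adj u (τ u) ∧
        ∀ u', G.Adj u u' → G.weight u (τ u) + c * x (τ u) ≤ G.weight u u' + c * x u') ∧
      (∀ u, G.owner u = true → x u = G.weight u (σ u) + c * x (σ u)) ∧
      (∀ u, G.owner u = false → x u = G.weight u (τ u) + c * x (τ u)) := by
  classical
  -- out-neighbourhoods as nonempty finsets
  let S : V → Finset V := fun u => Finset.univ.filter (G.Adj u)
  have hS : ∀ u, (S u).Nonempty := fun u => by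
    obtain ⟨u', h⟩ := hG u
    exact ⟨u', by simp [S, h]⟩
  have hmemS : ∀ u u', u' ∈ S u ↔ G.Adj u u' := fun u u' => by simp [S]
  -- the Shapley operator
  let T : (V → ℝ) → (V → ℝ) := fun x u =>
    if G.owner u then (S u).sup' (hS u) (fun u' => G.weight u u' + c * x u')
    else (S u).inf' (hS u) (fun u' => G.weight u u' + c * x u')
  -- it is a `c`-contraction for the sup metric
  have hT : ∀ x y : V → ℝ, dist (T x) (T y) ≤ c * dist x y := by
    intro x y
    refine (dist_pi_le_iff (mul_nonneg hc0 dist_nonneg)).2 fun u => ?_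
    have hcoord : ∀ u', |(G.weight u u' + c * x u') - (G.weight u u' + c * y u')|
        ≤ c * dist x y := by
      intro u'
      rw [show (G.weight u u' + c * x u') - (G.weight u u' + c * y u') = c * (x u' - y u') by
        ring, abs_mul, abs_of_nonneg hc0, ← Real.dist_eq]
      exact mul_le_mul_of_nonneg_left (dist_le_pi_dist x y u') hc0
    rw [Real.dist_eq, abs_sub_le_iff]
    simp only [T]
    split_ifs with ho
    · constructor
      · rw [sub_le_iff_le_add]
        refine Finset.sup'_le _ _ fun u' hu' => ?_
        have h1 := (abs_sub_le_iff.1 (hcoord u')).1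
        have h2 : G.weight u u' + c * y u'
            ≤ (S u).sup' (hS u) (fun u' => G.weight u u' + c * y u') :=
          Finset.le_sup' (fun u' => G.weight u u' + c * y u') hu'
        linarith
      · rw [sub_le_iff_le_add]
        refine Finset.sup'_le _ _ fun u' hu' => ?_
        have h1 := (abs_sub_le_iff.1 (hcoord u')).2
        have h2 : G.weight u u' + c * x u'
            ≤ (S u).sup' (hS u) (fun u' => G.weight u u' + c * x u') :=
          Finset.le_sup' (fun u' => G.weight u u' + c * x u') hu'
        linarith
    · constructor
      · rw [sub_le_iff_le_add, ← sub_le_iff_le_add']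
        refine Finset.le_inf' _ _ fun u' hu' => ?_
        have h1 := (abs_sub_le_iff.1 (hcoord u')).1
        have h2 : (S u).inf' (hS u) (fun u' => G.weight u u' + c * x u')
            ≤ G.weight u u' + c * x u' :=
          Finset.inf'_le (fun u' => G.weight u u' + c * x u') hu'
        linarith
      · rw [sub_le_iff_le_add, ← sub_le_iff_le_add']
        refine Finset.le_inf' _ _ fun u' hu' => ?_
        have h1 := (abs_sub_le_iff.1 (hcoord u')).2
        have h2 : (S u).inf' (hS u) (fun u' => G.weight u u' + c * y u')
            ≤ G.weight u u' + c * y u' :=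
          Finset.inf'_le (fun u' => G.weight u u' + c * y u') hu'
        linarith
  have hK : ContractingWith ⟨c, hc0⟩ T := by
    refine ⟨?_, LipschitzWith.of_dist_le_mul fun x y => hT x y⟩
    rw [← NNReal.coe_lt_coe]
    exact hc1
  obtain ⟨x, hx⟩ : ∃ x : V → ℝ, T x = x :=
    ⟨ContractingWith.fixedPoint T hK, hK.fixedPoint_isFixedPt⟩
  -- greedy selections
  choose σ hσS hσeq using fun u =>
    Finset.exists_mem_eq_sup' (hS u) (fun u' => G.weight u u' + c * x u')
  choose τ hτS hτeq using fun u =>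
    Finset.exists_mem_eq_inf' (hS u) (fun u' => G.weight u u' + c * x u')
  refine ⟨x, σ, τ, fun u => ⟨(hmemS u _).1 (hσS u), fun u' hu' => ?_⟩,
    fun u => ⟨(hmemS u _).1 (hτS u), fun u' hu' => ?_⟩, fun u hu => ?_, fun u hu => ?_⟩
  · rw [← hσeq u]
    exact Finset.le_sup' (fun u' => G.weight u u' + c * x u') ((hmemS u u').2 hu')
  · rw [← hτeq u]
    exact Finset.inf'_le (fun u' => G.weight u u' + c * x u') ((hmemS u u').2 hu')
  · have h := congr_fun hx u
    simp only [T, hu, if_true] at h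
    rw [← h, hσeq u]
  · have h := congr_fun hx u
    simp only [T, hu] at h
    rw [← h, hτeq u]
    simp

/-- **Positional determinacy of mean-payoff games, uniform version.** On a finite arena without
sinks there are a value function `ν : V → ℝ` and positional strategies `σ` of Max and `τ` of Min
such that from EVERY start vertex `v`, `σ` secures `liminf` mean payoff `≥ ν v` and `τ` secures
`limsup` mean payoff `≤ ν v`. Proof by the vanishing-discount argument of the module docstring
(discounted fixed points, pigeonhole over greedy pairs, Bolzano–Weierstrass, telescoping).
[cite: EhrenfeuchtMycielski1979, Thms 1–2; restated ZwickPaterson1995 §1] -/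
theorem exists_positional_optimal (G : MeanPayoffGame V ℝ) (hG : G.IsTotal) :
    ∃ (ν : V → ℝ) (σ τ : V → V), G.IsPositional true σ ∧ G.IsPositional false τ ∧
      ∀ v, G.SecuresGe (positional σ) v (ν v) ∧ G.SecuresLe (positional τ) v (ν v) := by
  classical
  -- a bound on the weights
  obtain ⟨W, hW0, hW⟩ : ∃ W : ℝ, 0 ≤ W ∧ ∀ u u', |G.weight u u'| ≤ W := by
    obtain ⟨W, hW⟩ := Finite.exists_le fun p : V × V => |G.weight p.1 p.2|
    exact ⟨max W 0, le_max_right _ _, fun u u' => (hW (u, u')).trans (le_max_left _ _)⟩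
  -- discount factors `lam n = 1 - 1/(n+1) → 1`
  set lam : ℕ → ℝ := fun n => 1 - 1 / ((n : ℝ) + 1) with hlam
  have h1lam : ∀ n, 1 - lam n = 1 / ((n : ℝ) + 1) := fun n => by simp only [hlam]; ring
  have hlam0 : ∀ n, 0 ≤ lam n := fun n => by
    have h : (1 : ℝ) / ((n : ℝ) + 1) ≤ 1 := by
      rw [div_le_one (by positivity)]
      linarith [(Nat.cast_nonneg n : (0 : ℝ) ≤ n)]
    simp only [hlam]
    linarith
  have hlam1 : ∀ n, lam n < 1 := fun n => by
    have h : (0 : ℝ) < 1 / ((n : ℝ) + 1) := by positivity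
    simp only [hlam]
    linarith
  -- discounted values and greedy pairs for every `n`
  choose x σ τ hσ hτ hxmax hxmin using fun n => G.exists_discountedValue hG (hlam0 n) (hlam1 n)
  -- `(1 - lam n) • x n` is bounded by `W`
  have hxb : ∀ n u, |(1 - lam n) * x n u| ≤ W := by
    intro n u
    haveI : Nonempty V := ⟨u⟩
    obtain ⟨u₀, hu₀⟩ := Finite.exists_max fun u => |x n u|
    have hrec : ∀ u, |x n u| ≤ W + lam n * |x n u₀| := by
      intro u
      have key : ∀ u', |G.weight u u' + lam n * x n u'| ≤ W + lam n * |x n u₀| := by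
        intro u'
        calc |G.weight u u' + lam n * x n u'| ≤ |G.weight u u'| + |lam n * x n u'| :=
              abs_add_le _ _
          _ ≤ W + lam n * |x n u₀| := by
              rw [abs_mul, abs_of_nonneg (hlam0 n)]
              exact add_le_add (hW _ _) (mul_le_mul_of_nonneg_left (hu₀ _) (hlam0 n))
      cases h : G.owner u
      · rw [hxmin n u h]
        exact key _
      · rw [hxmax n u h]
        exact key _
    have hM : (1 - lam n) * |x n u₀| ≤ W := by
      have := hrec u₀
      linarith
    calc |(1 - lam n) * x n u| = (1 - lam n) * |x n u| := by
          rw [abs_mul, abs_of_nonneg (sub_nonneg.2 (hlam1 n).le)]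
      _ ≤ (1 - lam n) * |x n u₀| := mul_le_mul_of_nonneg_left (hu₀ u) (sub_nonneg.2 (hlam1 n).le)
      _ ≤ W := hM
  -- pigeonhole: a greedy pair that occurs infinitely often
  obtain ⟨⟨σ₀, τ₀⟩, hp⟩ := Finite.exists_infinite_fiber fun n => (σ n, τ n)
  have hfreq : ∃ᶠ n in atTop, (σ n, τ n) = (σ₀, τ₀) := by
    rw [Nat.frequently_atTop_iff_infinite]
    have hinf := Set.infinite_coe_iff.1 hp
    have hset : ((fun n => (σ n, τ n)) ⁻¹' {(σ₀, τ₀)}) = {n | (σ n, τ n) = (σ₀, τ₀)} := by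
      ext n
      simp
    rwa [hset] at hinf
  obtain ⟨φ, hφ, hφp⟩ := extraction_of_frequently_atTop hfreq
  -- Bolzano–Weierstrass along that subsequence
  have hbd : ∀ n, (fun u => (1 - lam (φ n)) * x (φ n) u) ∈ Metric.closedBall (0 : V → ℝ) W := by
    intro n
    rw [Metric.mem_closedBall, dist_pi_le_iff hW0]
    intro u
    rw [Pi.zero_apply, Real.dist_eq, sub_zero]
    exact hxb _ _
  obtain ⟨ν, -, ψ, hψ, hlim⟩ := tendsto_subseq_of_bounded Metric.isBounded_closedBall hbd
  -- collect the data along `e = φ ∘ ψ`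
  obtain ⟨e, he, heσ, heτ, hlim⟩ : ∃ e : ℕ → ℕ, Tendsto e atTop atTop ∧ (∀ n, σ (e n) = σ₀) ∧
      (∀ n, τ (e n) = τ₀) ∧
      Tendsto (fun n u => (1 - lam (e n)) * x (e n) u) atTop (𝓝 ν) :=
    ⟨fun n => φ (ψ n), hφ.tendsto_atTop.comp hψ.tendsto_atTop,
      fun n => (Prod.ext_iff.1 (hφp (ψ n))).1, fun n => (Prod.ext_iff.1 (hφp (ψ n))).2,
      hlim⟩
  -- limits along `e`
  have h1l : Tendsto (fun n => 1 - lam (e n)) atTop (𝓝 0) := by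
    simp only [h1lam]
    exact (tendsto_one_div_add_atTop_nhds_zero_nat (𝕜 := ℝ)).comp he
  have hl : Tendsto (fun n => lam (e n)) atTop (𝓝 1) := by
    have := (tendsto_const_nhds (x := (1 : ℝ))).sub h1l
    simpa using this
  have hν : ∀ u, Tendsto (fun n => (1 - lam (e n)) * x (e n) u) atTop (𝓝 (ν u)) := fun u =>
    tendsto_pi_nhds.1 hlim u
  have h1e0 : ∀ n, 0 ≤ 1 - lam (e n) := fun n => sub_nonneg.2 (hlam1 _).le
  -- passing to the limit in `A n ≤ (1 - lam) * w + lam * B n`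
  have hle : ∀ (A B : ℕ → ℝ) (a b w : ℝ), Tendsto A atTop (𝓝 a) → Tendsto B atTop (𝓝 b) →
      (∀ n, A n ≤ (1 - lam (e n)) * w + lam (e n) * B n) → a ≤ b := by
    intro A B a b w hA hB h
    have hR : Tendsto (fun n => (1 - lam (e n)) * w + lam (e n) * B n) atTop
        (𝓝 (0 * w + 1 * b)) := (h1l.mul_const w).add (hl.mul hB)
    rw [zero_mul, one_mul, zero_add] at hR
    exact le_of_tendsto_of_tendsto' hA hR h
  have hge : ∀ (A B : ℕ → ℝ) (a b w : ℝ), Tendsto A atTop (𝓝 a) → Tendsto B atTop (𝓝 b) →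
      (∀ n, (1 - lam (e n)) * w + lam (e n) * B n ≤ A n) → b ≤ a := by
    intro A B a b w hA hB h
    have hR : Tendsto (fun n => (1 - lam (e n)) * w + lam (e n) * B n) atTop
        (𝓝 (0 * w + 1 * b)) := (h1l.mul_const w).add (hl.mul hB)
    rw [zero_mul, one_mul, zero_add] at hR
    exact le_of_tendsto_of_tendsto' hR hA h
  -- the four limit relations of step 3
  have hm₁ : ∀ u, G.owner u = true → ν u ≤ ν (σ₀ u) := by
    intro u hu
    refine hle _ _ _ _ (G.weight u (σ₀ u)) (hν u) (hν (σ₀ u)) fun n => le_of_eq ?_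
    have h := hxmax (e n) u hu
    rw [heσ n] at h
    rw [h]
    ring
  have hm₂ : ∀ u, G.owner u = true → ∀ u', G.Adj u u' → ν u' ≤ ν u := by
    intro u hu u' huu'
    refine hge _ _ _ _ (G.weight u u') (hν u) (hν u') fun n => ?_
    have h := hxmax (e n) u hu
    have h' := (hσ (e n) u).2 u' huu'
    rw [heσ n] at h h'
    calc (1 - lam (e n)) * G.weight u u' + lam (e n) * ((1 - lam (e n)) * x (e n) u')
        = (1 - lam (e n)) * (G.weight u u' + lam (e n) * x (e n) u') := by ring
      _ ≤ (1 - lam (e n)) * (G.weight u (σ₀ u) + lam (e n) * x (e n) (σ₀ u)) :=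
          mul_le_mul_of_nonneg_left h' (h1e0 n)
      _ = (1 - lam (e n)) * x (e n) u := by rw [h]
  have hm₃ : ∀ u, G.owner u = false → ν (τ₀ u) ≤ ν u := by
    intro u hu
    refine hge _ _ _ _ (G.weight u (τ₀ u)) (hν u) (hν (τ₀ u)) fun n => le_of_eq ?_
    have h := hxmin (e n) u hu
    rw [heτ n] at h
    rw [h]
    ring
  have hm₄ : ∀ u, G.owner u = false → ∀ u', G.Adj u u' → ν u ≤ ν u' := by
    intro u hu u' huu'
    refine hle _ _ _ _ (G.weight u u') (hν u) (hν u') fun n => ?_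
    have h := hxmin (e n) u hu
    have h' := (hτ (e n) u).2 u' huu'
    rw [heτ n] at h h'
    calc (1 - lam (e n)) * x (e n) u
        = (1 - lam (e n)) * (G.weight u (τ₀ u) + lam (e n) * x (e n) (τ₀ u)) := by rw [h]
      _ ≤ (1 - lam (e n)) * (G.weight u u' + lam (e n) * x (e n) u') :=
          mul_le_mul_of_nonneg_left h' (h1e0 n)
      _ = (1 - lam (e n)) * G.weight u u' + lam (e n) * ((1 - lam (e n)) * x (e n) u') := by
          ring
  -- uniform `δ`-closeness at some index
  have hclose : ∀ δ : ℝ, 0 < δ → ∃ n, ∀ u, |(1 - lam (e n)) * x (e n) u - ν u| ≤ δ := by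
    intro δ hδ
    obtain ⟨N, hN⟩ := Metric.tendsto_atTop.1 hlim δ hδ
    refine ⟨N, fun u => ?_⟩
    rw [← Real.dist_eq]
    exact (dist_le_pi_dist (fun u => (1 - lam (e N)) * x (e N) u) ν u).trans (hN N le_rfl).le
  refine ⟨ν, σ₀, τ₀, fun u _ => ?_, fun u _ => ?_, fun v => ⟨?_, ?_⟩⟩
  · rw [← heσ 0]
    exact (hσ (e 0) u).1
  · rw [← heτ 0]
    exact (hτ (e 0) u).1
  · refine securesGe_of_vanishingDiscount G σ₀ ν hm₁ hm₄ (fun δ hδ => ?_) v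
    obtain ⟨n, hn⟩ := hclose δ hδ
    refine ⟨lam (e n), x (e n), hlam0 _, (hlam1 _).le, hn, fun u hu => ?_, fun u hu u' huu' => ?_⟩
    · have h := hxmax (e n) u hu
      rw [heσ n] at h
      exact h.le
    · have h := hxmin (e n) u hu
      have h' := (hτ (e n) u).2 u' huu'
      linarith
  · refine securesLe_of_vanishingDiscount G τ₀ ν hm₃ hm₂ (fun δ hδ => ?_) v
    obtain ⟨n, hn⟩ := hclose δ hδ
    refine ⟨lam (e n), x (e n), hlam0 _, (hlam1 _).le, hn, fun u hu => ?_, fun u hu u' huu' => ?_⟩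
    · have h := hxmin (e n) u hu
      rw [heτ n] at h
      exact h.ge
    · have h := hxmax (e n) u hu
      have h' := (hσ (e n) u).2 u' huu'
      linarith

end Discounted

end MeanPayoffGame

/-- **The Ehrenfeucht–Mycielski theorem** (discharge of the named fact
`EhrenfeuchtMycielski1979_positionalDeterminacy`): on a finite arena without sinks, from every
start vertex `v` there are a value `ν` and POSITIONAL strategies `σ` of Max and `τ` of Min with
every play from `v` conforming to `σ` of `liminf` mean payoff `≥ ν` and every play from `v`
conforming to `τ` of `limsup` mean payoff `≤ ν`. From the uniform version
`MeanPayoffGame.exists_positional_optimal` (vanishing-discount proof, see the module docstring).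
[cite: EhrenfeuchtMycielski1979, Thms 1–2; restated ZwickPaterson1995 §1] -/
theorem EhrenfeuchtMycielski1979_positionalDeterminacy_holds :
    EhrenfeuchtMycielski1979_positionalDeterminacy := by
  intro k G hG v
  obtain ⟨ν, σ, τ, hσ, hτ, h⟩ := G.exists_positional_optimal hG
  exact ⟨ν v, σ, τ, hσ, hτ, (h v).1, (h v).2⟩

end Literature.Computability.Complexity
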